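import Summits.AtomisticToContinuum.Crystallization.Theorems.FrustratedLawDichotomyPairPotentialDoor

/-!
# FrustratedLawDichotomy · motif certificates are a FINITE family: the packing bound on motif size

The motif doors (`…MotifDoor.localDischargingRuleT_of_motif`, `…PairPotentialDoor.pairRuleCertificate_of_motif`) quantify the per-motif
inequality over motifs `z : Fin M → ℝ³` of EVERY size `M`.  A `7/10`-separated motif confined to radius `ϱ` about its centre has at most
`(20ϱ/7 + 1)³` atoms (volume packing, `Literature…card_le_of_separated_of_dist_le`), so the family is FINITE in `M`:

* `motif_card_le` — `Sep z`, `z` injective, all atoms within `ϱ ≥ 0` of `z c` ⟹ `(M : ℝ) ≤ (20ϱ/7 + 1)³`;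
* `pairRuleMotifCertificate_iff_bounded`, `motifCertificateT_iff_bounded`, `motifCertificateF_iff_bounded` — each motif certificate is
  EQUIVALENT to its restriction to motif sizes `M` with `(M : ℝ) ≤ (20ϱ/7 + 1)³` (so a census engine enumerates `M = 1 … ⌊(20ϱ/7 + 1)³⌋` only).

DEF-FREE; [folklore]; 0 sorry.  Prover hand 2, gen 12 (decomp-a2c), `--supports stmt-AtomisticToContinuum-27623`.
-/

noncomputable section

namespace Summit.AtomisticToContinuum.Crystallization.Theorems.FrustratedLawDichotomyMotifCount

open scoped BigOperators Classical
open Literature.MathematicalPhysics.StatisticalMechanics (card_le_of_separated_of_dist_le)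
open Summit.AtomisticToContinuum.Crystallization.Theorems.ChargedEnergyGapNegative (E3)
open Summit.AtomisticToContinuum.Crystallization.Theorems.FrustratedLawDichotomyRangeCut (Sep)
open Summit.AtomisticToContinuum.Crystallization.Theorems.FrustratedLawDichotomyLocalDischargingRule (TransferRule)
open Summit.AtomisticToContinuum.Crystallization.Theorems.FrustratedLawDichotomyMotifDoor (MotifCertificateT MotifCertificateF)
open Summit.AtomisticToContinuum.Crystallization.Theorems.FrustratedLawDichotomyPairPotentialDoor (PairRuleMotifCertificate)

/-- ★ **Motif size bound**: an injective `7/10`-separated motif confined to radius `ϱ ≥ 0` about one of its atoms has at most `(20ϱ/7 + 1)³` atoms.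
[folklore] -/
theorem motif_card_le {ϱ : ℝ} (hϱ : 0 ≤ ϱ) {M : ℕ} {z : Fin M → E3} (hz : Function.Injective z) (hsep : Sep z) {c : Fin M}
    (hconf : ∀ a : Fin M, dist (z a) (z c) ≤ ϱ) : (M : ℝ) ≤ (20 * ϱ / 7 + 1) ^ 3 := by
  have hcard : ((Finset.univ.image z).card : ℝ) = M := by
    rw [Finset.card_image_of_injective _ hz, Finset.card_univ, Fintype.card_fin]
  have h := card_le_of_separated_of_dist_le (Finset.univ.image z) (z c) (r := 7 / 10) (R := ϱ) (by norm_num) hϱ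
    (fun x hx => by
      obtain ⟨a, -, rfl⟩ := Finset.mem_image.mp hx
      exact hconf a)
    (fun x hx w hw hxw => by
      obtain ⟨a, -, rfl⟩ := Finset.mem_image.mp hx
      obtain ⟨b, -, rfl⟩ := Finset.mem_image.mp hw
      exact hsep a b fun hab => hxw (congrArg z hab))
  rw [hcard, finrank_euclideanSpace, Fintype.card_fin] at h
  have e : (2 * ϱ / (7 / 10) + 1 : ℝ) = 20 * ϱ / 7 + 1 := by ring
  rw [e] at h
  exact h

/-- ★ **The pair-functional motif certificate is a finite family in the motif size.** [folklore] -/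
theorem pairRuleMotifCertificate_iff_bounded {η₀ η₁ : ℝ} {W : ℝ → ℝ} {A c₀ c₁ c₂ D ϱ : ℝ} {F : TransferRule} (hϱ : 0 ≤ ϱ) :
    PairRuleMotifCertificate η₀ η₁ W A c₀ c₁ c₂ D ϱ F ↔
      ∀ (M : ℕ), (M : ℝ) ≤ (20 * ϱ / 7 + 1) ^ 3 → ∀ (z : Fin M → E3), Function.Injective z → Sep z → ∀ c : Fin M,
        (∀ a : Fin M, dist (z a) (z c) ≤ ϱ) →
          c₀ + c₁ * (if FrustratedLawDichotomyMotifLemmas.GoodAtScale η₀ D z c then (1 : ℝ) else 0)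
              + c₂ * (if FrustratedLawDichotomyMotifLemmas.GoodAtScale η₁ D z c then (1 : ℝ) else 0) ≤
            (∑ a, W (dist (z c) (z a)) - W 0) / 2 - A + FrustratedLawDichotomyLocalDischargingRule.netInflow F M z c :=
  ⟨fun h M _ z hz hsep c hconf => h M z hz hsep c hconf,
    fun h M z hz hsep c hconf => h M (motif_card_le hϱ hz hsep hconf) z hz hsep c hconf⟩

/-- **`MotifCertificateT` is a finite family in the motif size.** [folklore] -/
theorem motifCertificateT_iff_bounded {η₀ η₁ R A eUp κT CT D ϱ : ℝ} {F : TransferRule} (hϱ : 0 ≤ ϱ) :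
    MotifCertificateT η₀ η₁ R A eUp κT CT D ϱ F ↔
      ∀ (M : ℕ), (M : ℝ) ≤ (20 * ϱ / 7 + 1) ^ 3 → ∀ (z : Fin M → E3), Function.Injective z → Sep z → ∀ c : Fin M,
        (∀ a : Fin M, dist (z a) (z c) ≤ ϱ) →
          eUp + κT * (1 - (if FrustratedLawDichotomyMotifLemmas.GoodAtScale η₁ D z c then (1 : ℝ) else 0))
              - CT * (if FrustratedLawDichotomyMotifLemmas.GoodAtScale η₀ D z c then (1 : ℝ) else 0) ≤
            (∑ a, FrustratedLawDichotomyRangeCut.truncLJ R (dist (z c) (z a))) / 2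
              - A * FrustratedLawDichotomyRangeCut.densityProxy z c + FrustratedLawDichotomyLocalDischargingRule.netInflow F M z c :=
  ⟨fun h M _ z hz hsep c hconf => h M z hz hsep c hconf,
    fun h M z hz hsep c hconf => h M (motif_card_le hϱ hz hsep hconf) z hz hsep c hconf⟩

/-- **`MotifCertificateF` is a finite family in the motif size.** [folklore] -/
theorem motifCertificateF_iff_bounded {R A e₁ C D ϱ : ℝ} {F : TransferRule} (hϱ : 0 ≤ ϱ) :
    MotifCertificateF R A e₁ C D ϱ F ↔
      ∀ (M : ℕ), (M : ℝ) ≤ (20 * ϱ / 7 + 1) ^ 3 → ∀ (z : Fin M → E3), Function.Injective z → Sep z → ∀ c : Fin M,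
        (∀ a : Fin M, dist (z a) (z c) ≤ ϱ) →
          e₁ - C * (if FrustratedLawDichotomyMotifLemmas.GoodAtScale (1 / 20) D z c then (1 : ℝ) else 0) ≤
            (∑ a, FrustratedLawDichotomyRangeCut.truncLJ R (dist (z c) (z a))) / 2
              - A * FrustratedLawDichotomyRangeCut.densityProxy z c + FrustratedLawDichotomyLocalDischargingRule.netInflow F M z c :=
  ⟨fun h M _ z hz hsep c hconf => h M z hz hsep c hconf,
    fun h M z hz hsep c hconf => h M (motif_card_le hϱ hz hsep hconf) z hz hsep c hconf⟩

/-- **Literal**: at motif radius `ϱ = 8` (e.g. range `5`, `R′ + ρ ≤ 3`) a motif has at most `(160/7 + 1)³ < 13582` atoms. [folklore] -/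
theorem motif_card_le_eight {M : ℕ} {z : Fin M → E3} (hz : Function.Injective z) (hsep : Sep z) {c : Fin M}
    (hconf : ∀ a : Fin M, dist (z a) (z c) ≤ 8) : (M : ℝ) < 13582 := by
  have h := motif_card_le (by norm_num) hz hsep hconf
  have : (20 * (8 : ℝ) / 7 + 1) ^ 3 < 13582 := by norm_num
  linarith

end Summit.AtomisticToContinuum.Crystallization.Theorems.FrustratedLawDichotomyMotifCount

end
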